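import Mathlib
import Summits.Ventures.PercRepro2.CoinDefs
import Summits.Ventures.PercRepro2.CoinOrTailKDefs
import Summits.Ventures.PercRepro2.CoinTreeCore
import Summits.Ventures.PercRepro2.CoinKSureCoins

/-!
# The virtual labelling from a cardinality bound (blind cell PercRepro2, night-2 g14;
proofs/NIGHT2-DARC.md §49.7)

`darc_of_orTailK_coins` asks for an injective labelling of the entries by vertices outside
`U ∪ {a, w}`; such a labelling exists as soon as the vertex type has room,
`ent.card + (U ∪ {a, w}).card ≤ Fintype.card V` (`Function.Embedding.nonempty_of_card_le`).
`darc_of_orTailK_coins_card` / `darc_of_orTailTreeK_coins_card` state row 2′DARC with that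
cardinality bound in place of the labelling.
-/

namespace Summit.Ventures.PercRepro2.Coin

open Classical

section CoinsCard

variable {V : Type*} {E : Type*} [Fintype V] [DecidableEq V] [Fintype E] [DecidableEq E]
  {R : Type*} [Field R] [LinearOrder R] [IsStrictOrderedRing R]
  {arcs : E → Finset (V × V)} {s : V} {U : Finset V} {ent : Finset V} {c : V → E} {a w : V}

/-- An injective labelling of the entries outside `U ∪ {a, w}` exists when there is room. -/
lemma exists_virtual_labels (hcard : ent.card + (U ∪ {a, w}).card ≤ Fintype.card V) :
    ∃ vt : V → V, (∀ r ∈ ent, vt r ∉ U ∧ vt r ≠ a ∧ vt r ≠ w) ∧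
      (∀ r ∈ ent, ∀ r' ∈ ent, vt r = vt r' → r = r') := by
  have hc : Fintype.card {v // v ∈ ent} ≤ Fintype.card {v // v ∈ (U ∪ {a, w})ᶜ} := by
    rw [Fintype.card_coe, Fintype.card_coe, Finset.card_compl]
    omega
  obtain ⟨f⟩ := Function.Embedding.nonempty_of_card_le hc
  refine ⟨fun v => if hv : v ∈ ent then (f ⟨v, hv⟩).1 else v, ?_, ?_⟩
  · intro r hr
    have hmem := (f ⟨r, hr⟩).2
    simp only [dif_pos hr]
    rw [Finset.mem_compl, Finset.mem_union, Finset.mem_insert, Finset.mem_singleton, not_or,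
      not_or] at hmem
    exact ⟨hmem.1, hmem.2.1, hmem.2.2⟩
  · intro r hr r' hr' heq
    simp only [dif_pos hr, dif_pos hr'] at heq
    have := f.injective (Subtype.ext heq)
    exact Subtype.mk.inj this

/-- **THEOREM (row 2′DARC at an OR-tail with ANY entry set and ARBITRARY coins, with a
cardinality bound in place of the virtual labelling).** -/
theorem darc_of_orTailK_coins_card (pr : E → R) (hp : IsProbVec pr) (hS : SameEnds arcs)
    (h : OrTailK arcs s U ent c a) {m₁ m₂ : V} (hm₁ : m₁ ∈ U) (hm₂ : m₂ ∈ U)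
    (hcard : ent.card + (U ∪ {a, w}).card ≤ Fintype.card V)
    (hν : ∀ W W', W ⊆ U → W' ⊆ U →
      prob pr (coreLevel arcs s U W) * prob pr (coreLevel arcs s U W') ≤
        prob pr (coreLevel arcs s U (W ∩ W')) * prob pr (coreLevel arcs s U (W ∪ W')))
    {t : V} (htC : t ∉ insert a U) (hts : t ≠ s) (hws : w ≠ s) (hwC : w ∉ insert a U) :
    DARC pr arcs s {t} m₁ m₂ a w := by
  obtain ⟨vt, hvt, hvtinj⟩ := exists_virtual_labels (U := U) (ent := ent) (a := a) (w := w) hcard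
  exact darc_of_orTailK_coins pr hp hS h hm₁ hm₂ vt hvt hvtinj hν htC hts hws hwC

/-- **COROLLARY (out-tree core, any entry set, arbitrary coins, cardinality bound).** -/
theorem darc_of_orTailTreeK_coins_card (pr : E → R) (hp : IsProbVec pr) (hS : SameEnds arcs)
    (h : OrTailK arcs s U ent c a) {c' : V → E} {par : V → V} {rk : V → ℕ}
    (hT : TreeCore arcs s U c' par rk) {m₁ m₂ : V} (hm₁ : m₁ ∈ U) (hm₂ : m₂ ∈ U)
    (hcard : ent.card + (U ∪ {a, w}).card ≤ Fintype.card V)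
    {t : V} (htC : t ∉ insert a U) (hts : t ≠ s) (hws : w ≠ s) (hwC : w ∉ insert a U) :
    DARC pr arcs s {t} m₁ m₂ a w :=
  darc_of_orTailK_coins_card pr hp hS h hm₁ hm₂ hcard (hT.coreLevel_lsm pr hp) htC hts hws hwC

end CoinsCard

end Summit.Ventures.PercRepro2.Coin
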